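import Mathlib
import HarnessLib
import Summits.KontsevichZagierPeriods.KontsevichZagierPeriods.Theses.LinRedNormalForm
import Summits.KontsevichZagierPeriods.KontsevichZagierPeriods.Theorems.LinRedNormalFormDihedralNormalFormStubNestedReductionAux5
import Summits.KontsevichZagierPeriods.KontsevichZagierPeriods.Theorems.LinRedNormalFormDihedralNormalFormStubNestedReductionAux6

/-!
# `DihedralNormalForm`, line `torus-descent-sum-shadow`, stub `stub_nestedReduction` — Aux 7

Support file for the stub `stub_nestedReduction` (THEOREM N) of the crux `DihedralNormalForm`
(stmt-KontsevichZagierPeriods-3912, route `LinRedNormalForm`): **the axis Newton–Leibniz move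
on a cubical atom** (`Nested.atomAxisNL`).  For an atom-shaped primitive
`F = [A, E]` (coefficient `c`) with `A p ≥ 1` (so `F|_{x_p = 0} = 0`) and `E p p ≥ 0`, the
representations of the terms of `∂_p F = c·A p·[A − 𝟙_p, E] − Σ_{[i,j] ∋ p} c·E i j·[A − 𝟙_p +
𝟙_{[i,j]}, E − δ_{ij}]` (Aux 5) are congruent modulo `KZ.relations` to the base
`[(0,1)ⁿ, y ↦ F (insertNth p 1 y)]` (Aux 6 `Nested.nl_axis_ocube`; the base is absolutely
convergent by Tonelli and the fibrewise Newton–Leibniz inequality).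

References: M. Kontsevich, D. Zagier, *Periods* (2001), §1.2, rules (1), (3).
-/

noncomputable section

open MeasureTheory Set
open scoped ENNReal

namespace Summit.KontsevichZagierPeriods.DihedralNormalForm.TorusDescent

open Literature.NumberTheory.Transcendental
open Literature.ModelTheory.ExponentialFields (IsSemialgebraic)

namespace Nested

variable {n : ℕ}

/-! ## Fibrewise facts -/

/-- The cofactor of the singleton chord `{p}` is `1`. -/
theorem cof_self (p : Fin (n + 1)) (y : Fin n → ℝ) : cof p p p y = 1 := by
  unfold cof
  refine Finset.prod_eq_one fun l _ => ?_
  rw [if_neg]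
  rintro ⟨h1, h2⟩
  exact Fin.succAbove_ne p l (le_antisymm h2 h1)

/-- A chord through the axis other than `{p}` does not degenerate on the closed fibre. -/
theorem one_sub_mul_cof_pos {p : Fin (n + 1)} {ij : Fin (n + 1) × Fin (n + 1)} (hij : ij ∈ thru p)
    (hne : ij ≠ (p, p)) {y : Fin n → ℝ} (hy : y ∈ ocube n) {t : ℝ} (ht : t ∈ Icc (0:ℝ) 1) :
    0 < 1 - t * cof p ij.1 ij.2 y := by
  rw [mem_thru] at hij
  have hlt : cof p ij.1 ij.2 y < 1 :=
    cof_lt_one (hij.1.trans hij.2) (fun h => hne (Prod.ext h.1 h.2)) hy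
  have h0 : 0 ≤ cof p ij.1 ij.2 y := (cof_pos p ij.1 ij.2 hy).le
  nlinarith [ht.1, ht.2]

/-- No chord through the axis degenerates on the open fibre. -/
theorem one_sub_mul_cof_ne_zero {p : Fin (n + 1)} {y : Fin n → ℝ} (hy : y ∈ ocube n) {t : ℝ}
    (ht : t ∈ Ioo (0:ℝ) 1) : ∀ ij ∈ thru p, 1 - t * cof p ij.1 ij.2 y ≠ 0 := by
  intro ij _
  have h1 : t * cof p ij.1 ij.2 y ≤ t * 1 := mul_le_mul_of_nonneg_left (cof_le_one p _ _ hy) ht.1.le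
  nlinarith [ht.2]

/-- The core is continuous on the closed fibre as soon as the exponent of `{p}` is `≥ 0`. -/
theorem continuousOn_core (p : Fin (n + 1)) (N : ℕ) {E : Fin (n + 1) → Fin (n + 1) → ℤ}
    (hE : 0 ≤ E p p) {y : Fin n → ℝ} (hy : y ∈ ocube n) : ContinuousOn (core p N E y) (Icc 0 1) := by
  unfold core
  refine (continuousOn_id.pow N).mul (continuousOn_finsetProd _ fun ij hij => ?_)
  have hlin : Continuous fun t : ℝ => 1 - t * cof p ij.1 ij.2 y := by fun_prop
  by_cases hne : ij = (p, p)
  · subst hne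
    exact hlin.continuousOn.zpow₀ _ fun t _ => Or.inr hE
  · exact hlin.continuousOn.zpow₀ _ fun t ht => Or.inl (one_sub_mul_cof_pos hij hne hy ht).ne'

/-- An atom is continuous on the closed fibre as soon as the exponent of `{p}` is `≥ 0`. -/
theorem continuousOn_atomQ_insertNth (q : ℚ) (A : Fin (n + 1) → ℕ) {E : Fin (n + 1) → Fin (n + 1) → ℤ}
    (p : Fin (n + 1)) (hE : 0 ≤ E p p) {y : Fin n → ℝ} (hy : y ∈ ocube n) :
    ContinuousOn (fun t : ℝ => atomQ (n + 1) q A E (Fin.insertNth p t y)) (Icc 0 1) := by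
  simp only [atomQ_insertNth]
  exact continuousOn_const.mul (continuousOn_core p _ hE hy)

/-- The Newton–Leibniz integrand is continuous on the closed fibre (`E p p ≥ 0`; the `{p}`-term
has coefficient `E p p`, hence vanishes when its own exponent would be negative). -/
theorem continuousOn_dAtom_insertNth (q : ℚ) (A : Fin (n + 1) → ℕ) {E : Fin (n + 1) → Fin (n + 1) → ℤ}
    (p : Fin (n + 1)) (hE : 0 ≤ E p p) {y : Fin n → ℝ} (hy : y ∈ ocube n) :
    ContinuousOn (fun t : ℝ => dAtom q A E p (Fin.insertNth p t y)) (Icc 0 1) := by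
  unfold dAtom
  refine (continuousOn_atomQ_insertNth _ _ p hE hy).sub (continuousOn_finsetSum _ fun ij hij => ?_)
  by_cases h0 : ij = (p, p) ∧ E p p = 0
  · obtain ⟨rfl, h0⟩ := h0
    have : (fun t : ℝ => atomQ (n + 1) (q * (E p p : ℚ)) (aterm A p p p) (esub E p p)
        (Fin.insertNth p t y)) = fun _ => 0 := by
      funext t; simp [atomQ, h0]
    rw [this]
    exact continuousOn_const
  · refine continuousOn_atomQ_insertNth _ _ p ?_ hy
    unfold esub
    split_ifs with h
    · have : ij = (p, p) := Prod.ext h.1.symm h.2.symm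
      have hne : E p p ≠ 0 := fun h' => h0 ⟨this, h'⟩
      omega
    · exact hE

/-- The primitive vanishes on the face `x_p = 0` (`A p ≥ 1`). -/
theorem atomQ_insertNth_zero (q : ℚ) {A : Fin (n + 1) → ℕ} (E : Fin (n + 1) → Fin (n + 1) → ℤ)
    {p : Fin (n + 1)} (hA : 1 ≤ A p) (y : Fin n → ℝ) :
    atomQ (n + 1) q A E (Fin.insertNth p 0 y) = 0 := by
  rw [atomQ_insertNth, core, zero_pow (by omega), zero_mul, mul_zero]

/-! ## Semialgebraicity -/

/-- The Newton–Leibniz integrand is `ℚ`-semialgebraic on every `ℚ`-semialgebraic set. -/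
theorem isSemialgebraicFunOn_dAtom {S : Set (Fin (n + 1) → ℝ)} (hS : IsSemialgebraic ℚ S) (q : ℚ)
    (A : Fin (n + 1) → ℕ) (E : Fin (n + 1) → Fin (n + 1) → ℤ) (p : Fin (n + 1)) :
    IsSemialgebraicFunOn ℚ S (dAtom q A E p) :=
  (isSemialgebraicFunOn_atomQ hS _ _ _).fun_sub
    (IsSemialgebraicFunOn.fun_finsetSum _ hS fun _ _ => isSemialgebraicFunOn_atomQ hS _ _ _)

/-- The restriction of an atom to the face `x_p = 1` is `ℚ`-semialgebraic on the open cube. -/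
theorem isSemialgebraicFunOn_atomQ_insertNth_one (q : ℚ) (A : Fin (n + 1) → ℕ)
    (E : Fin (n + 1) → Fin (n + 1) → ℤ) (p : Fin (n + 1)) :
    IsSemialgebraicFunOn ℚ (ocube n) (fun y => atomQ (n + 1) q A E (Fin.insertNth p 1 y)) := by
  have hS := isSemialgebraic_ocube n
  have h1 : IsSemialgebraicFunOn ℚ (ocube n) fun _ : Fin n → ℝ => (1 : ℝ) := by
    simpa using isSemialgebraicFunOn_const_ratCast hS 1
  exact (isSemialgebraicFunOn_const_ratCast hS q).fun_mul
    (isSemialgebraicFunOn_atomFun_comp hS A E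
      (X := fun y : Fin n → ℝ => (Fin.insertNth p (1:ℝ) y : Fin (n + 1) → ℝ))
      fun i => isSemialgebraicFunOn_insertNth h1 (fun j => isSemialgebraicFunOn_apply hS j) p i)

/-! ## The move -/

/-- **The axis Newton–Leibniz move on an atom.**  Let `F = c·[A, E]` with `A p ≥ 1`, `E p p ≥ 0`,
and let `Ra`, `Rt ij` (`[i,j] ∋ p`) be representations on the open cube of the terms
`c·A p·[A − 𝟙_p, E]` and `c·E i j·[A − 𝟙_p + 𝟙_{[i,j]}, E − δ_{ij}]` of `∂_p F`.  Then the base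
`rb = [(0,1)ⁿ, y ↦ F (insertNth p 1 y)]` is a representation and
`[Ra] − Σ [Rt ij] − [rb] ∈ KZ.relations`. -/
theorem atomAxisNL (p : Fin (n + 1)) (c : ℚ) (A : Fin (n + 1) → ℕ) (E : Fin (n + 1) → Fin (n + 1) → ℤ)
    (hA : 1 ≤ A p) (hE : 0 ≤ E p p)
    (Ra : KZ.IntegralRep (n + 1)) (hRa : Ra.domain = ocube (n + 1))
    (hRa' : EqOn Ra.integrand (atomQ (n + 1) (c * A p) (adown A p) E) Ra.domain)
    (Rt : Fin (n + 1) × Fin (n + 1) → KZ.IntegralRep (n + 1))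
    (hRt : ∀ ij ∈ thru p, (Rt ij).domain = ocube (n + 1))
    (hRt' : ∀ ij ∈ thru p, EqOn (Rt ij).integrand
      (atomQ (n + 1) (c * E ij.1 ij.2) (aterm A p ij.1 ij.2) (esub E ij.1 ij.2)) (Rt ij).domain) :
    ∃ rb : KZ.IntegralRep n, rb.domain = ocube n ∧
      rb.integrand = (fun y => atomQ (n + 1) c A E (Fin.insertNth p 1 y)) ∧
      KZ.of Ra - ∑ ij ∈ thru p, KZ.of (Rt ij) - KZ.of rb ∈ KZ.relations := by
  have hmeas : MeasurableSet (ocube (n + 1)) := measurableSet_ocube (n + 1)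
  -- the representation of `∂_p F` on the open cube
  have hWint : IntegrableOn (dAtom c A E p) (ocube (n + 1)) := by
    have h1 : IntegrableOn Ra.integrand (ocube (n + 1)) := hRa ▸ Ra.integrableOn
    have h2 : IntegrableOn (fun x => ∑ ij ∈ thru p, (Rt ij).integrand x) (ocube (n + 1)) :=
      integrable_finsetSum _ fun ij hij => (hRt ij hij) ▸ (Rt ij).integrableOn
    refine (h1.sub h2).congr_fun (fun x hx => ?_) hmeas
    rw [Pi.sub_apply, dAtom, hRa' (hRa ▸ hx)]
    congr 1
    exact Finset.sum_congr rfl fun ij hij => hRt' ij hij ((hRt ij hij).symm ▸ hx)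
  set R := cubeRep (n + 1) (dAtom c A E p) (isSemialgebraicFunOn_dAtom (isSemialgebraic_ocube _) c A E p)
    hWint with hR
  -- rule 1b: `[Ra] − [R] − Σ [Rt] ∈ relations`
  have h1b : KZ.of Ra - (KZ.of R + ∑ ij ∈ thru p, KZ.of (Rt ij)) ∈ KZ.relations := by
    let G : Option (Fin (n + 1) × Fin (n + 1)) → KZ.IntegralRep (n + 1) := fun o => o.elim R Rt
    have h := KZ.of_sub_sum_integrand_mem_relations (Finset.insertNone (thru p)) G Ra ?_ ?_
    · simpa [Finset.sum_insertNone, G] using h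
    · intro o ho
      rw [Finset.mem_insertNone] at ho
      cases o with
      | none => rw [hRa]; rfl
      | some ij => rw [hRa]; exact hRt ij (ho ij rfl)
    · intro x hx
      simp only [Finset.sum_insertNone, G, Option.elim]
      change Ra.integrand x = dAtom c A E p x + ∑ ij ∈ thru p, (Rt ij).integrand x
      rw [dAtom, hRa' hx, Finset.sum_congr rfl fun ij hij => hRt' ij hij ((hRt ij hij).symm ▸ (hRa ▸ hx))]
      ring
  -- the base: integrable by Tonelli and the fibrewise Newton–Leibniz inequality
  set K : (Fin n → ℝ) → ℝ := fun y => atomQ (n + 1) c A E (Fin.insertNth p 1 y) with hK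
  have hKsa : IsSemialgebraicFunOn ℚ (ocube n) K := isSemialgebraicFunOn_atomQ_insertNth_one c A E p
  have hKint : IntegrableOn K (ocube n) := by
    -- the relabelled kernel is integrable on the closed band
    have hW' : IntegrableOn (fun w : Fin (n + 1) → ℝ => dAtom c A E p (fun i => w (reix p i)))
        (cband n) := by
      have h := (R.reindex (reix p)).integrableOn
      rw [KZ.IntegralRep.reindex_integrand, KZ.IntegralRep.reindex_domain] at h
      have hdom : {w : Fin (n + 1) → ℝ | (fun i => w (reix p i)) ∈ R.domain} = ocube (n + 1) := by
        ext w; exact comp_reix_mem_ocube_iff p w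
      rw [hdom] at h
      exact h.mono_set_ae (ae_le_set.mpr (volume_cband_diff n))
    refine integrableOn_of_lintegral_fibre_ge (measurableSet_ocube n)
      ((isSemialgebraic_cband n).measurableSet_holds) (a := fun _ => 0) (b := fun _ => 1)
      (fun x t => by rw [cband_eq]; exact KZlog.snoc_mem_band) hW'
      (KZ.aestronglyMeasurable_of_isSemialgebraicFunOn hKsa (measurableSet_ocube n)) fun y hy => ?_
    simp only [snoc_comp_reix]
    have hsub : K y = atomQ (n + 1) c A E (Fin.insertNth p 1 y) - atomQ (n + 1) c A E (Fin.insertNth p 0 y) := by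
      rw [atomQ_insertNth_zero c E hA, sub_zero]
    rw [hsub]
    exact enorm_sub_le_lintegral_Icc (F := fun t => atomQ (n + 1) c A E (Fin.insertNth p t y))
      zero_le_one (continuousOn_atomQ_insertNth c A p hE hy)
      (fun t ht => hasDerivAt_atomQ_insertNth c A E p y (one_sub_mul_cof_ne_zero hy ht))
      (continuousOn_dAtom_insertNth c A p hE hy)
  set rb := cubeRep n K hKsa hKint with hrb
  -- rule 3 along the axis
  have hNL : KZ.of R - KZ.of rb ∈ KZ.relations := by
    refine nl_axis_ocube p R rb (atomQ (n + 1) c A E) (dAtom c A E p) rfl (fun _ _ => rfl) rfl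
      (isSemialgebraicFunOn_dAtom (isSemialgebraic_aband p) c A E p)
      (isSemialgebraicFunOn_atomQ (isSemialgebraic_aband p) c A E)
      (fun y hy => continuousOn_atomQ_insertNth c A p hE hy)
      (fun y hy t ht => hasDerivAt_atomQ_insertNth c A E p y (one_sub_mul_cof_ne_zero hy ht))
      fun y _ => ?_
    change K y = _
    rw [atomQ_insertNth_zero c E hA, sub_zero]
  refine ⟨rb, rfl, rfl, ?_⟩
  have := add_mem h1b hNL
  convert this using 1
  abel

end Nested

/-- **Registered sub-goal `stub_nestedReductionAux7`**: the restriction of a cubical atom to a face `x_p = 1` is a `ℚ`-semialgebraic function on the open cube. -/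
theorem stub_nestedReductionAux7 : ∀ (n : ℕ) (q : ℚ) (A : Fin (n + 1) → ℕ) (E : Fin (n + 1) → Fin (n + 1) → ℤ) (p : Fin (n + 1)), Literature.NumberTheory.Transcendental.IsSemialgebraicFunOn ℚ {x : Fin n → ℝ | ∀ i, x i ∈ Set.Ioo (0:ℝ) 1} (fun y => (q : ℝ) * ((∏ i : Fin (n + 1), (Fin.insertNth p (1:ℝ) y) i ^ A i) * ∏ i : Fin (n + 1), ∏ j : Fin (n + 1), if i ≤ j then (1 - (∏ l : Fin (n + 1), if i ≤ l ∧ l ≤ j then (Fin.insertNth p (1:ℝ) y) l else 1)) ^ E i j else 1)) :=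
  fun _ q A E p =>
    Nested.isSemialgebraicFunOn_atomQ_insertNth_one q A E p

end Summit.KontsevichZagierPeriods.DihedralNormalForm.TorusDescent
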